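import Summits.ResolutionOfSingularities.ResolutionOfSingularities.Theorems.FrobeniusClosingSteerHironakaLUIsolatedBranchOfCP
import HarnessLib

/-!
# Crux `Steer` (stmt-ResolutionOfSingularities-16345), chain W4.1, §σ2.25 v2 F-A3 (c = 3): an eternal STRIPPED isolated
# radicand chain in dimension three which is EVENTUALLY UNSTRIPPED is impossible — Cossart–Piltant 2019 Thm. 1.5 debt

OURS (campaign `res-hironaka`, rung L ★L-G4, slot W4.1, seat `res-type-026`; res-L0-w41-plan-1 RULINGS 25/27/28
(2026-08-27T08:58–09:06Z): F-A3 target `NoEternalStrippedRadicandChain p c` = the K(c) chain binders with the radicand law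
`f (m+1) · (x m)^(p · e m) = f m − (g m)^p`, `e m ≥ 1`, isolatedness KEPT; 026's DETERMINACY FLAG 09:08:18Z: split into the
eventually-unstripped part (CP debt) and the infinitely-stripped part (frontier relative to print); NOT a statement of the
manuscript under review; AI review is weaker than expert review).

`StrippedChainThree.false_of_eventuallyUnstripped (hCP)`: under the K(3) binders of
`NoEternalChainThree.noEternalIsolatedRadicandChain_three` (p509311) with the GENERALISED law
`f (m+1) · (x m)^(p · e m) = f m − (g m)^p` and the extra binder «`e m = 1` for `m ≥ m₀`», False — by re-indexing the tail
`m ↦ m₀ + m` (a verbatim K(3) chain) onto p509311; the CP debt is `CossartPiltant2019HironakaLUIsolatedBranch`, i.e.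
(`…_of_localPermissible{,Sing}`, my p513630) the printed-shape fact `CossartPiltant2019LocalPermissible{,Sing}` = CP2019
Thm. 1.5 [v1 1.4] (i).  WHY ONLY THE EVENTUALLY-UNSTRIPPED PART (determinacy flag): CP's theorem is existential; it is pinned
to a given chain only where the chain's next centre is the unique Hironaka-permissible one; a stripping step `e ≥ 2` passes
through the intermediate germ `S (m+1)[θ₁]`, `θ₁^p = x^{p(e−1)} f (m+1)`, at which both the closed point and the divisor
`(x, θ₁)` are Hironaka-permissible (Def. 2.7 (i), arXiv v1 chunk p. 14), so CP's sequence may leave the chain there.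
[cite: CossartPiltant2019, Thm. 1.5 (arXiv v1: Thm. 1.4), Def. 2.7] [folklore]
-/

noncomputable section

-- `Summit.<S>.<S>.…` duplicates the summit name by design (single-problem summit).
set_option linter.dupNamespace false

open Polynomial IsLocalRing

namespace Summit.ResolutionOfSingularities.ResolutionOfSingularities.Theorems.SwitchingDichotomy

open Literature.AlgebraicGeometry.Resolution

namespace StrippedChainThree

/-- **No eternal isolated radicand chain in dimension three with stripped law, eventually unstripped** — modulo
`CossartPiltant2019HironakaLUIsolatedBranch` (hence modulo the printed-shape CP2019 Thm. 1.5 facts via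
`HironakaLUBranchOfCP.hironakaLUIsolatedBranch_of_localPermissible{,Sing}`: e.g.
`false_of_eventuallyUnstripped (HironakaLUBranchOfCP.hironakaLUIsolatedBranch_of_localPermissibleSing hCP') p hp`).
Binders: those of
`NoEternalChainThree.noEternalIsolatedRadicandChain_three` VERBATIM except the radicand law, which carries the stripping
exponents `e m ≥ 1`, plus `hev : ∃ m₀, ∀ m, m₀ ≤ m → e m = 1`.  Proof: the tail `m ↦ m₀ + m` is a K(3) chain.
[cite: CossartPiltant2019, Thm. 1.5 (arXiv v1: Thm. 1.4)] [folklore] -/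
theorem false_of_eventuallyUnstripped (hCP : CossartPiltant2019HironakaLUIsolatedBranch.{0})
    (p : ℕ) (hp : p.Prime) :
    ∀ (L : Type) [Field L] [CharP L p] (S : ℕ → Subring L) [∀ m, IsLocalRing (S m)]
      (hle : ∀ m, S m ≤ S (m + 1)) (f g : ∀ m, S m) (x : ∀ m, S (m + 1)) (e : ℕ → ℕ),
      (∀ m, 1 ≤ e m) →
      (∀ m, IsRegularLocalRing (S m)) → (∀ m, IsExcellentRing (S m)) → (∀ m, ringKrullDim (S m) = (3 : ℕ)) →
      (∀ m, IsQuadraticTransform (S m) (S (m + 1))) →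
      (∀ m, Ideal.span ((fun y : S m => (⟨(y : L), hle m y.2⟩ : S (m + 1))) ''
          (maximalIdeal (S m) : Set (S m))) = Ideal.span {x m}) →
      (∀ m, ((f (m + 1) : S (m + 1)) : L) * ((x m : S (m + 1)) : L) ^ (p * e m) =
          ((f m : S m) : L) - ((g m : S m) : L) ^ p) →
      (∀ m, ∃ h : S m, f m - h ^ p ∈ maximalIdeal (S m) ^ p) →
      (∀ m, ∀ (P : Ideal (AdjoinRoot ((X : (S m)[X]) ^ p - C (f m)))) [P.IsPrime],
          (∃ Q : Ideal (AdjoinRoot ((X : (S m)[X]) ^ p - C (f m))), Q.IsPrime ∧ P < Q) →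
          IsRegularLocalRing (Localization.AtPrime P)) →
      (∃ m₀, ∀ m, m₀ ≤ m → e m = 1) →
      False := by
  intro L _ _ S _ hle f g x e _he hreg hexc hdim hQT hspan hrel hmult hisol hev
  obtain ⟨m₀, hm₀⟩ := hev
  -- the tail `m ↦ m₀ + m` is a K(3) chain VERBATIM
  refine NoEternalChainThree.noEternalIsolatedRadicandChain_three hCP p hp L (fun m => S (m₀ + m))
    (fun m => hle (m₀ + m)) (fun m => f (m₀ + m)) (fun m => g (m₀ + m)) (fun m => x (m₀ + m))
    (fun m => hreg (m₀ + m)) (fun m => hexc (m₀ + m)) (fun m => hdim (m₀ + m)) (fun m => hQT (m₀ + m))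
    (fun m => hspan (m₀ + m)) (fun m => ?_) (fun m => hmult (m₀ + m)) (fun m => hisol (m₀ + m))
  have h1 : e (m₀ + m) = 1 := hm₀ (m₀ + m) (Nat.le_add_right m₀ m)
  have := hrel (m₀ + m)
  rw [h1, mul_one] at this
  exact this

end StrippedChainThree

end Summit.ResolutionOfSingularities.ResolutionOfSingularities.Theorems.SwitchingDichotomy

end
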